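import Mathlib
import Literature.Computability.AlgebraicComplexity.DeterminantalComplexity
import Literature.Computability.AlgebraicComplexity.PermanentVsDeterminant
import Literature.Computability.AlgebraicComplexity.LandsbergRessayreNormalForm
import Summits.ValiantsHypothesis.ValiantsHypothesis.Theses.DetQP

/-!
# Sketch — crux-ideate stmt-ValiantsHypothesis-0318 (ideator 2): first lemmas of the idea cards

Card `vertex-power-width`: the VERTEX NORMAL FORM.  Every affine determinantal representation of
`per_n` (`n ≥ 3`) is regular (von zur Gathen, in tree `vonzurGathen1987_perm_detRepr_rank_holds`;
LR17 normal form `IsRegularDetRepr.exists_normalForm`), and because `per_n` is HOMOGENEOUS the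
normal form at the cone vertex `x = 0` collapses, with no junk terms, to a bordered matrix power:
`per_n = ρᵀ L^(n-2) γ` with `ρ, γ, L` LINEAR, of width `w = dc - 1`, together with the Krylov side
identities `ρᵀ L^j γ = 0 (j < n-2)` and `per_n ∣ ρᵀ L^j γ` (all `j`).

Card `markov-divisibility` (second lever, same normal form, different object): the hypersurface
`Z(per_n)` is the preimage of the codimension-`w` variety of SISO linear systems with identically
vanishing transfer function under the LINEAR map `x ↦ (L(x), γ(x), ρ(x))`.
-/

namespace Summit.ValiantsHypothesis.ValiantsHypothesis.Cruxes.DetqpSuperquadratic.VertexPowerWidth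

open Literature.Computability.AlgebraicComplexity MvPolynomial Matrix

/-- Bordered matrix-power presentation of length `d` and width `w`:
`f = ρ ⬝ᵥ (L^(d-2) *ᵥ γ)` with `ρ, γ` vectors and `L` a `w × w` matrix of homogeneous LINEAR forms
(a homogeneous ABP with `d` layers of widths `1, w, …, w, 1` and ONE repeated matrix). -/
def HasBorderedPowerRepr {σ : Type*} (f : MvPolynomial σ ℂ) (d w : ℕ) : Prop :=
  ∃ (ρ γ : Fin w → MvPolynomial σ ℂ) (L : Matrix (Fin w) (Fin w) (MvPolynomial σ ℂ)),
    (∀ i, (ρ i).IsHomogeneous 1) ∧ (∀ i, (γ i).IsHomogeneous 1) ∧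
    (∀ i j, (L i j).IsHomogeneous 1) ∧ ρ ⬝ᵥ ((L ^ (d - 2)) *ᵥ γ) = f

/-- FIRST LEMMA of card `vertex-power-width` (vertex normal form ⇒ lossless bordered power
presentation with the Krylov side identities).  From a size-`w+1` affine determinantal
representation of `per_n`, `n ≥ 3`: linear `ρ, γ ∈ (S¹)^w`, `L ∈ M_w(S¹)` with
`per_n = ρᵀ L^(n-2) γ`, `ρᵀ L^j γ = 0` for `j < n - 2`, and `per_n ∣ ρᵀ L^j γ` for every `j`. -/
def VertexNormalForm : Prop :=
  ∀ n : ℕ, 3 ≤ n → ∀ w : ℕ, HasDetRepr (perPoly (Fin n) ℂ) (w + 1) →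
    ∃ (ρ γ : Fin w → MvPolynomial (Fin n × Fin n) ℂ)
      (L : Matrix (Fin w) (Fin w) (MvPolynomial (Fin n × Fin n) ℂ)),
      (∀ i, (ρ i).IsHomogeneous 1) ∧ (∀ i, (γ i).IsHomogeneous 1) ∧
      (∀ i j, (L i j).IsHomogeneous 1) ∧
      ρ ⬝ᵥ ((L ^ (n - 2)) *ᵥ γ) = perPoly (Fin n) ℂ ∧
      (∀ j < n - 2, ρ ⬝ᵥ ((L ^ j) *ᵥ γ) = 0) ∧
      (∀ j : ℕ, perPoly (Fin n) ℂ ∣ ρ ⬝ᵥ ((L ^ j) *ᵥ γ))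

/-- Corollary shape: `dc(per_n) ≥ 1 + (bordered power width)`, i.e. the minimal size is attained
by a representation whose vertex normal form has width `dc - 1`. -/
def DcGePowerWidth : Prop :=
  ∀ n : ℕ, 3 ≤ n → ∃ w : ℕ, w + 1 ≤ determinantalComplexity (perPoly (Fin n) ℂ) ∧
    HasBorderedPowerRepr (perPoly (Fin n) ℂ) n w

/-- TRANSFER `C⁺` of card `vertex-power-width`: the bordered power width of `per_n` is
super-quadratic (equivalently: every homogeneous single-matrix ABP `ρᵀ L^(n-2) γ` for `per_n` has
width `≥ n^(2+ε)`). -/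
def PowerWidthSuperquadratic : Prop :=
  ∃ ε : ℝ, 0 < ε ∧ ∃ n₀ : ℕ, ∀ n ≥ n₀, ∀ w : ℕ,
    HasBorderedPowerRepr (perPoly (Fin n) ℂ) n w → (n : ℝ) ^ (2 + ε) ≤ (w : ℝ)

/-- The transfer closes the crux BY NAME (checked composition; both hypotheses are this card's). -/
theorem detqpSuperquadratic_of (h1 : DcGePowerWidth) (h2 : PowerWidthSuperquadratic) :
    Summit.ValiantsHypothesis.ValiantsHypothesis.Theses.DetQP.DetqpSuperquadratic := by
  obtain ⟨ε, hε, n₀, h⟩ := h2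
  refine ⟨ε, hε, max n₀ 3, fun n hn => ?_⟩
  have hn₀ : n₀ ≤ n := le_trans (le_max_left _ _) hn
  have hn3 : 3 ≤ n := le_trans (le_max_right _ _) hn
  obtain ⟨w, hw, hrepr⟩ := h1 n hn3
  have h1' := h n hn₀ w hrepr
  have h2' : (w : ℝ) ≤ (determinantalComplexity (perPoly (Fin n) ℂ) : ℝ) := by
    exact_mod_cast (Nat.le_succ w).trans hw
  exact h1'.trans h2'

/-- COROLLARY B (the homogeneous-model dictionary made exact): a size-`w+1` representation makes
`per_n` a LINEAR specialisation of `IMM^n_w = tr(X₁ ⋯ X_n)` (tree: `immPoly w n ℂ`):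
`X₁ = e₁ ρᵀ`, `X₂ = ⋯ = X_{n-1} = L`, `X_n = γ e₁ᵀ`.  Contrapositive: any separation
`per_n ∉ End · IMM^n_w` (e.g. by the UNPADDED shifted partials of Gesmundo–Landsberg, which are
barred only for `w > n⁵`, tree `GesmundoLandsberg2017_thm2`) gives `dc(per_n) ≥ w + 2`. -/
def PerIsLinearIMMSpecialisation : Prop :=
  ∀ n : ℕ, 3 ≤ n → ∀ w : ℕ, HasDetRepr (perPoly (Fin n) ℂ) (w + 1) →
    ∃ g : Fin n × Fin w × Fin w → MvPolynomial (Fin n × Fin n) ℂ,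
      (∀ v, (g v).IsHomogeneous 1) ∧ MvPolynomial.aeval g (immPoly w n ℂ) = perPoly (Fin n) ℂ

/-! ### Second card `markov-divisibility`: the system-theoretic reading of the same normal form -/

/-- The variety `T₀(w)` of SISO linear systems `(A, b, c)` of order `w` with identically vanishing
transfer function `cᵀ (sI - A)⁻¹ b ≡ 0`, i.e. all Markov parameters `cᵀ A^j b` vanish
(codimension `w` in `gl_w × ℂ^w × ℂ^w`). -/
def zeroTransferLocus (w : ℕ) : Set (Matrix (Fin w) (Fin w) ℂ × (Fin w → ℂ) × (Fin w → ℂ)) :=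
  {s | ∀ j : ℕ, s.2.2 ⬝ᵥ ((s.1 ^ j) *ᵥ s.2.1) = 0}

/-- FIRST LEMMA of card `markov-divisibility`: for every affine determinantal representation of
`per_n` (`n ≥ 3`) of size `w + 1`, in vertex normal form `x ↦ (L(x), γ(x), ρ(x))` (entrywise
evaluation of the linear data at the point `x`), the permanental hypersurface is EXACTLY the
preimage of `T₀(w)`: `per_n(x) = 0 ↔ (L(x), γ(x), ρ(x)) ∈ T₀(w)`. -/
def HypersurfaceIsZeroTransferSection : Prop :=
  ∀ n : ℕ, 3 ≤ n → ∀ w : ℕ, HasDetRepr (perPoly (Fin n) ℂ) (w + 1) →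
    ∃ (ρ γ : Fin w → MvPolynomial (Fin n × Fin n) ℂ)
      (L : Matrix (Fin w) (Fin w) (MvPolynomial (Fin n × Fin n) ℂ)),
      (∀ i, (ρ i).IsHomogeneous 1) ∧ (∀ i, (γ i).IsHomogeneous 1) ∧
      (∀ i j, (L i j).IsHomogeneous 1) ∧
      ρ ⬝ᵥ ((L ^ (n - 2)) *ᵥ γ) = perPoly (Fin n) ℂ ∧
      ∀ x : Fin n × Fin n → ℂ,
        MvPolynomial.eval x (perPoly (Fin n) ℂ) = 0 ↔
          (L.map (MvPolynomial.eval x), fun i => MvPolynomial.eval x (γ i),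
            fun i => MvPolynomial.eval x (ρ i)) ∈ zeroTransferLocus w

end Summit.ValiantsHypothesis.ValiantsHypothesis.Cruxes.DetqpSuperquadratic.VertexPowerWidth
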